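import Literature.AlgebraicGeometry.HodgeTheory.NoTypeIVFactorProducts
import Literature.AlgebraicGeometry.HodgeTheory.RealMultiplicationHodgeGroupEqLefschetz
import Literature.AlgebraicGeometry.HodgeTheory.MurtyTotallyRealMaximalSubfieldHodgeClasses
import Literature.AlgebraicGeometry.HodgeTheory.HodgeGroupProductSemisimpleCMFactor
import Mathlib.NumberTheory.NumberField.InfinitePlace.TotallyRealComplex
import HarnessLib

/-!
# The product lane on POWERS: HC_CM ∧ (Lombardo–Moonen–Zarhin span) ⟹ HC(`A^{N+1} × C`) for `A` of type I–III with divisorial powers and `C` of CM type — the binder `HasNoTypeIVFactor (A.powSucc N)` discharged from the factor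

Family `hodge`, layer `Literature/AlgebraicGeometry/HodgeTheory`. Research context: cell `pub-hodge-ring2`,
HONEST FRAMING: research route conditional on HC_CM; not a corollary; Q11.4-sentence-2 already refuted in
dim ≥ 3. Literature lane. This file only COMPOSES tree theorems: the product-lane frame
`hodgeConjectureFor_prod_of_cmHodgeHypothesis` (Moonen–Zarhin 1999 Thm. (3.2)(2) / Lombardo 2016 Lemma 3.4,
`HodgeGroupProductCMFactor`) and its rows for powers (`HodgeGroupProductCMFactorClasses`,
`MurtyTotallyRealMaximalSubfieldHodgeClasses`, `RealMultiplicationHodgeGroupEqLefschetz`) carried an EXPLICIT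
hypothesis `h4 : HasNoTypeIVFactor (X.powSucc N)` («the tree's `End⁰` of a power is not computed from
`End⁰(X)`, so it is not derived here»); `NoTypeIVFactorProducts` now derives it
(`HasNoTypeIVFactor.powSucc`, `.prod`, `.of_isIsogenous`), so the rows below take `HasNoTypeIVFactor X` of
the BASE variety — or nothing at all when `End⁰(X)` is a totally real field (Ribet) or contains a totally
real self-commutant subfield (Murty), where it is a theorem (`hasNoTypeIVFactor_of_isTotallyReal`,
`hasNoTypeIVFactor_of_isMurtyTypeWith`).

WHAT IS CONDITIONAL ON WHAT (binders displayed in every signature): `hCM : ∀ B, CMHodgeHypothesisAt B`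
(HC for CM abelian varieties, Milne's per-variety form = HC_CM); `hL : Lombardo2016_hodgeClassesProductSpan`
(named fact, Lombardo 2016 Lemma 3.4 / Moonen–Zarhin 1999 (3.1)–(3.2)); for the Tankeev–Ribet and Murty
rows additionally the named facts `TankeevRibet1983_…` / `Murty1988_…`. UNCONDITIONAL: the real-multiplication
row's left factor (`AbelianVariety.isDivisorGenerated_powSucc_of_isTotallyReal`, Ribet 1983 Thm. 0 at relative
dimension one, a tree theorem) and all `HasNoTypeIVFactor` statements. No new named fact (D-0026); no new
definition.

MAIN RESULTS:
* `hasNoTypeIVFactor_powSucc_of_isTotallyReal` — all powers of an abelian variety whose endomorphism algebra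
  is a totally real field are free of type-IV factors;
* `hasNoTypeIVFactor_of_isMurtyTypeWith`, `hasNoTypeIVFactor_of_hasTotallyRealOddMaxSubfield` (+ `_powSucc`,
  `_of_isIsogenous_powSucc`) — Murty packets are free of type-IV factors (a central element commutes with
  `φ(K)`, hence lies in `φ(K)`, `K` totally real);
* `hodgeConjectureFor_powSucc_prod_cmType_of_isTotallyReal_of_cmHodgeHypothesis` — HC_CM ∧ hL ⟹
  HC(`A^{N+1} × C`) for `End⁰(A)` a totally real field of degree `dim A`, `C` of CM type (HC of the left
  factor unconditional); `…_of_isIsogenous_…` its isogeny closure (van Geemen Lemma 3.7);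
* `hodgeConjectureFor_powSucc_prod_of_cmHodgeHypothesis` — the general power row: `HasNoTypeIVFactor X`,
  HC(`X^{N+1}`), `C` of CM type ⟹ HC(`X^{N+1} × C`) under hCM ∧ hL;
* `hodgeConjectureFor_powSucc_prod_of_cmHodgeHypothesis_of_tankeevRibet'` — the Tankeev–Ribet power row of
  `HodgeGroupProductCMFactorClasses` with `h4` on `X` instead of on `X^{N+1}`;
* `hodgeConjectureFor_powSucc_prod_of_isMurtyTypeWith_of_cmHodgeHypothesis` — the Murty power row WITHOUT
  any type-IV binder.
On path: every target is a CASE of the Hodge conjecture (`hodgeConjectureFor_prod_of_hodgeConjecture` of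
`HodgeGroupProductCMFactor`); nothing here is summit progress by itself.

## References

* [MoonenZarhin1999LowDim] B. Moonen, Yu. Zarhin, Math. Ann. 315 (1999), §1 and Thm. (3.2)(2).
  [cite: MoonenZarhin1999LowDim, §1 and Thm. (3.2)]
* [Lombardo2016] D. Lombardo, Ann. Inst. Fourier 66 (2016), Lemma 3.4 (p. 1229). [cite: Lombardo2016, Lemma 3.4 (p. 1229)]
* [Ribet1983] K. A. Ribet, Amer. J. Math. 105 (1983), Thms. 0–1. [cite: Ribet1983, Thm. 0–1]
* [Murty1988] V. K. Murty, *Hodge classes on abelian varieties of totally real type* … Thm. 2. [cite: Murty1988, Thm. 2]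
* [vanGeemen1994HodgeAV] B. van Geemen, LNM 1594 (1994), Lemma 3.7. [cite: vanGeemen1994HodgeAV, Lemma 3.7]
* [MumfordAV1970] D. Mumford, *Abelian Varieties*, §19 Cor. 2 (p. 174). [cite: MumfordAV1970, §19 Cor. 2 (p. 174)]
-/

noncomputable section

open CategoryTheory Module NumberField Polynomial

namespace Literature.AlgebraicGeometry.HodgeTheory

open Literature.AlgebraicGeometry.Motives (AbelianVariety)
open Literature.AlgebraicGeometry.ComplexMultiplication
open Literature.AlgebraicGeometry.Milne1999

/-! ### §1 Type I–III is inherited by powers: real multiplication and Murty packets -/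

/-- **All powers `A^{N+1}` of an abelian variety whose endomorphism algebra is a totally real field have no
factor of type IV.** [cite: MoonenZarhin1999LowDim, §1 and Thm. (3.2)] [cite: Ribet1983, Thm. 0–1] -/
theorem hasNoTypeIVFactor_powSucc_of_isTotallyReal (A : AbelianVariety ℂ) (hF : IsField A.endAlgebra)
    [IsTotallyReal (EndField A hF)] (N : ℕ) : HasNoTypeIVFactor (A.powSucc N) :=
  (hasNoTypeIVFactor_of_isTotallyReal A hF).powSucc N

/-- In a totally real number field every element is a root of its (non-zero) minimal polynomial over `ℚ`,
all of whose complex roots `φ(z)`, `φ : K → ℂ`, are real. [folklore] -/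
private theorem minpoly_roots_real_of_isTotallyReal' {K : Type*} [Field K] [NumberField K]
    [IsTotallyReal K] (z : K) :
    minpoly ℚ z ≠ 0 ∧ Polynomial.aeval z (minpoly ℚ z) = 0 ∧
      ∀ x : ℂ, Polynomial.aeval x (minpoly ℚ z) = 0 → x.im = 0 := by
  have hint : IsIntegral ℚ z := Algebra.IsIntegral.isIntegral z
  refine ⟨minpoly.ne_zero hint, minpoly.aeval ℚ z, fun x hx => ?_⟩
  have hx' : x ∈ (minpoly ℚ z).rootSet ℂ := by
    rw [Polynomial.mem_rootSet]
    exact ⟨minpoly.ne_zero hint, hx⟩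
  rw [← NumberField.Embeddings.range_eval_eq_rootSet_minpoly] at hx'
  obtain ⟨φ, rfl⟩ := hx'
  have hreal := RingHom.congr_fun
    (ComplexEmbedding.isReal_iff.1 (IsTotallyReal.complexEmbedding_isReal φ)) z
  rw [ComplexEmbedding.conjugate_coe_eq] at hreal
  exact Complex.conj_eq_iff_im.1 hreal

/-- **A Murty packet has no factor of type IV**: for `IsMurtyTypeWith A K φ m` (`K` totally real,
`φ : K →+* End⁰(A)` its own commutant), a central `z ∈ End⁰(A)` commutes with `φ(K)`, so `z = φ(k)`, and the
minimal polynomial of `k` over `ℚ` has only real complex roots. (Murty's class is of type I–III: the centre of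
`End⁰(A)` lies in the totally real field `φ(K)`.) [cite: Murty1988, Thm. 2] [cite: MoonenZarhin1999LowDim, §1 and Thm. (3.2)] -/
theorem hasNoTypeIVFactor_of_isMurtyTypeWith {K : Type} [Field K] [NumberField K] {A : AbelianVariety ℂ}
    {φ : K →+* A.endAlgebra} {m : ℕ} (hA : IsMurtyTypeWith A K φ m) : HasNoTypeIVFactor A := by
  haveI : IsTotallyReal K := hA.1
  intro z hz
  obtain ⟨k, rfl⟩ : z ∈ Set.range φ :=
    hA.2.1 z fun y => ((Subalgebra.mem_center_iff.1 hz) (φ y)).symm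
  obtain ⟨hne, hk, hroots⟩ := minpoly_roots_real_of_isTotallyReal' k
  refine ⟨minpoly ℚ k, hne, ?_, hroots⟩
  rw [show φ k = φ.toRatAlgHom k from rfl, Polynomial.aeval_algHom_apply, hk, map_zero]

/-- **`HasTotallyRealOddMaxSubfield A ⟹ HasNoTypeIVFactor A`.** [cite: Murty1988, Thm. 2] [cite: MoonenZarhin1999LowDim, §1 and Thm. (3.2)] -/
theorem hasNoTypeIVFactor_of_hasTotallyRealOddMaxSubfield {A : AbelianVariety ℂ}
    (hA : HasTotallyRealOddMaxSubfield A) : HasNoTypeIVFactor A := by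
  obtain ⟨K, _, _, φ, m, hA⟩ := hA
  exact hasNoTypeIVFactor_of_isMurtyTypeWith hA

/-- All powers of a Murty packet have no factor of type IV. [cite: Murty1988, Thm. 2] [cite: MoonenZarhin1999LowDim, §1 and Thm. (3.2)] -/
theorem hasNoTypeIVFactor_powSucc_of_isMurtyTypeWith {K : Type} [Field K] [NumberField K]
    {A : AbelianVariety ℂ} {φ : K →+* A.endAlgebra} {m : ℕ} (hA : IsMurtyTypeWith A K φ m) (N : ℕ) :
    HasNoTypeIVFactor (A.powSucc N) :=
  (hasNoTypeIVFactor_of_isMurtyTypeWith hA).powSucc N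

/-- **The cell predicate `(∃ A N, HasTotallyRealOddMaxSubfield A ∧ B ∼ A^{N+1}) ∧ HasNoTypeIVFactor B` of
`Ring2MotivMurtyTypeCells` has a redundant second conjunct**: `B ∼ A^{N+1}` with `A` of Murty type already gives
`HasNoTypeIVFactor B`. [cite: Murty1988, Thm. 2] [cite: MumfordAV1970, §19 Cor. 2 (p. 174)] -/
theorem hasNoTypeIVFactor_of_isIsogenous_powSucc_of_hasTotallyRealOddMaxSubfield {A B : AbelianVariety ℂ}
    (hA : HasTotallyRealOddMaxSubfield A) {N : ℕ} (h : AbelianVariety.IsIsogenous B (A.powSucc N)) :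
    HasNoTypeIVFactor B :=
  (hasNoTypeIVFactor_of_hasTotallyRealOddMaxSubfield hA).of_isIsogenous_powSucc h

/-! ### §2 The power rows of the product lane, conditional on HC_CM and the span fact -/

/-- **General power row.** Under HC_CM (`hCM`) and the span fact (`hL`): for `X` without type-IV factor, every
`N` with HC(`X^{N+1}`), and `C` of CM type, the Hodge conjecture holds for `X^{N+1} × C` — the frame
`hodgeConjectureFor_prod_of_cmHodgeHypothesis` at `A = X^{N+1}`, its binder `HasNoTypeIVFactor (X.powSucc N)`
now derived from `HasNoTypeIVFactor X`. [cite: MoonenZarhin1999LowDim, §1 and Thm. (3.2)] [cite: Lombardo2016, Lemma 3.4 (p. 1229)] -/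
theorem hodgeConjectureFor_powSucc_prod_of_cmHodgeHypothesis
    (hCM : ∀ B : AbelianVariety ℂ, Milne1999.CMHodgeHypothesisAt B)
    (hL : Lombardo2016_hodgeClassesProductSpan) (X C : AbelianVariety ℂ) (h4 : HasNoTypeIVFactor X)
    (hCt : Milne1999.IsOfCMType C) (N : ℕ) (hX : HodgeConjectureFor (X.powSucc N).dim (X.powSucc N).X) :
    HodgeConjectureFor ((X.powSucc N).prod C).dim ((X.powSucc N).prod C).X :=
  hodgeConjectureFor_prod_of_cmHodgeHypothesis hCM hL (X.powSucc N) C (h4.powSucc N) hCt hX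

/-- **General power row, divisorial form**: `B(X^{N+1}) = D(X^{N+1})` (`IsDivisorGenerated`) gives HC(`X^{N+1}`)
by Lefschetz `(1,1)` (`hodgeConjectureFor_of_isDivisorGenerated`). [cite: MoonenZarhin1999LowDim, §1 and Thm. (3.2)]
[cite: Lombardo2016, Lemma 3.4 (p. 1229)] [cite: vanGeemen1994HodgeAV, §2.4] -/
theorem hodgeConjectureFor_powSucc_prod_of_cmHodgeHypothesis_of_isDivisorGenerated
    (hCM : ∀ B : AbelianVariety ℂ, Milne1999.CMHodgeHypothesisAt B)
    (hL : Lombardo2016_hodgeClassesProductSpan) (X C : AbelianVariety ℂ) (h4 : HasNoTypeIVFactor X)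
    (hCt : Milne1999.IsOfCMType C) (N : ℕ) (hD : IsDivisorGenerated (X.powSucc N)) :
    HodgeConjectureFor ((X.powSucc N).prod C).dim ((X.powSucc N).prod C).X :=
  hodgeConjectureFor_prod_of_cmHodgeHypothesis_of_isDivisorGenerated hCM hL (X.powSucc N) C (h4.powSucc N)
    hCt hD

/-- **Real-multiplication power row (Ribet, relative dimension one) — left factor UNCONDITIONAL.** Under HC_CM
and the span fact: for `A` with `End⁰(A)` a totally real field of degree `dim A`, every `N`, and `C` of CM type,
the Hodge conjecture holds for `A^{N+1} × C`. Inputs: `AbelianVariety.isDivisorGenerated_powSucc_of_isTotallyReal`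
(Ribet 1983 Thm. 0 at relative dimension one, tree theorem), `hasNoTypeIVFactor_powSucc_of_isTotallyReal`, the
frame. The `N`-free case `A × C` is `hodgeConjectureFor_prod_cmType_of_isTotallyReal_of_cmHodgeHypothesis`
(`RealMultiplicationHodgeGroupEqLefschetz`). [cite: Ribet1983, Thm. 0–1] [cite: MoonenZarhin1999LowDim, §1 and Thm. (3.2)]
[cite: Lombardo2016, Lemma 3.4 (p. 1229)] -/
theorem hodgeConjectureFor_powSucc_prod_cmType_of_isTotallyReal_of_cmHodgeHypothesis
    (hCM : ∀ B : AbelianVariety ℂ, Milne1999.CMHodgeHypothesisAt B)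
    (hL : Lombardo2016_hodgeClassesProductSpan) (A C : AbelianVariety ℂ) (hF : IsField A.endAlgebra)
    [IsTotallyReal (EndField A hF)] (hdeg : Module.finrank ℚ A.endAlgebra = A.dim) (N : ℕ)
    (hCt : Milne1999.IsOfCMType C) :
    HodgeConjectureFor ((A.powSucc N).prod C).dim ((A.powSucc N).prod C).X :=
  hodgeConjectureFor_prod_of_cmHodgeHypothesis hCM hL (A.powSucc N) C
    (hasNoTypeIVFactor_powSucc_of_isTotallyReal A hF N) hCt
    (hodgeConjectureFor_of_isDivisorGenerated _
      (AbelianVariety.isDivisorGenerated_powSucc_of_isTotallyReal A hF hdeg N))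

/-- **Isogeny closure of the real-multiplication power row**: `X ∼ A^{N+1} × C` ⟹ HC(`X`) under the same
binders (van Geemen Lemma 3.7 = `HodgeConjectureFor.of_isIsogenous`). [cite: vanGeemen1994HodgeAV, Lemma 3.7]
[cite: Ribet1983, Thm. 0–1] [cite: Lombardo2016, Lemma 3.4 (p. 1229)] -/
theorem hodgeConjectureFor_of_isIsogenous_powSucc_prod_cmType_of_isTotallyReal_of_cmHodgeHypothesis
    (hCM : ∀ B : AbelianVariety ℂ, Milne1999.CMHodgeHypothesisAt B)
    (hL : Lombardo2016_hodgeClassesProductSpan) {X : AbelianVariety ℂ} (A C : AbelianVariety ℂ)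
    (hF : IsField A.endAlgebra) [IsTotallyReal (EndField A hF)]
    (hdeg : Module.finrank ℚ A.endAlgebra = A.dim) {N : ℕ} (hCt : Milne1999.IsOfCMType C)
    (hX : AbelianVariety.IsIsogenous X ((A.powSucc N).prod C)) : HodgeConjectureFor X.dim X.X :=
  HodgeConjectureFor.of_isIsogenous hX
    (hodgeConjectureFor_powSucc_prod_cmType_of_isTotallyReal_of_cmHodgeHypothesis hCM hL A C hF hdeg N hCt)

/-- **Tankeev–Ribet power row with the type-IV binder on the base**: under HC_CM, the span fact and
Tankeev–Ribet (`hT`, Moonen–Zarhin 1999 Thm. (2.7)), for `X` simple of prime dimension without type-IV factor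
(`h4 : HasNoTypeIVFactor X`, i.e. `X` of type I, II or III), every `N` and every `C` of CM type:
HC(`X^{N+1} × C`). This is `hodgeConjectureFor_powSucc_prod_of_cmHodgeHypothesis_of_tankeevRibet`
(`HodgeGroupProductCMFactorClasses`) with its hypothesis `HasNoTypeIVFactor (X.powSucc N)` derived.
[cite: MoonenZarhin1999LowDim, §2 Thm. (2.7) and §3 (3.1)–(3.2)] [cite: Lombardo2016, Lemma 3.4 (p. 1229)] -/
theorem hodgeConjectureFor_powSucc_prod_of_cmHodgeHypothesis_of_tankeevRibet'
    (hCM : ∀ B : AbelianVariety ℂ, Milne1999.CMHodgeHypothesisAt B)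
    (hL : Lombardo2016_hodgeClassesProductSpan)
    (hT : TankeevRibet1983_hodgeClasses_divisorial_powers_simplePrimeDimension)
    (X : AbelianVariety ℂ) {p : ℕ} (hp : p.Prime) (hX : X.dim = p) (hs : X.IsSimple) (N : ℕ)
    (C : AbelianVariety ℂ) (h4 : HasNoTypeIVFactor X) (hCt : Milne1999.IsOfCMType C) :
    HodgeConjectureFor ((X.powSucc N).prod C).dim ((X.powSucc N).prod C).X :=
  hodgeConjectureFor_powSucc_prod_of_cmHodgeHypothesis_of_tankeevRibet hCM hL hT X hp hX hs N C
    (h4.powSucc N) hCt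

/-- **Murty power row WITHOUT a type-IV binder**: under HC_CM, the span fact and Murty's Thm. 2 (`hM`), for a
Murty packet `IsMurtyTypeWith A K φ m`, every `N` and every `C` of CM type: HC(`A^{N+1} × C`) — HC of the left
factor from Murty (`hodgeConjectureFor_powSucc_of_isMurtyTypeWith`), `HasNoTypeIVFactor (A.powSucc N)` from
`hasNoTypeIVFactor_powSucc_of_isMurtyTypeWith`. (The tree's `Ring2MotivMurtyTypeCells` row
`hodgeConjectureFor_powSucc_prod_of_isMurtyTypeWith_of_cmAbelianHodge` carries `h4` explicitly.)
[cite: Murty1988, Thm. 2] [cite: MoonenZarhin1999LowDim, §1 and Thm. (3.2)] [cite: Lombardo2016, Lemma 3.4 (p. 1229)] -/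
theorem hodgeConjectureFor_powSucc_prod_of_isMurtyTypeWith_of_cmHodgeHypothesis
    (hCM : ∀ B : AbelianVariety ℂ, Milne1999.CMHodgeHypothesisAt B)
    (hL : Lombardo2016_hodgeClassesProductSpan)
    (hM : Murty1988_hodgeClasses_divisorial_powers_totallyRealMaxSubfield_oddHalfRank)
    {K : Type} [Field K] [NumberField K] {A : AbelianVariety ℂ} {φ : K →+* A.endAlgebra} {m : ℕ}
    (hA : IsMurtyTypeWith A K φ m) (N : ℕ) (C : AbelianVariety ℂ) (hCt : Milne1999.IsOfCMType C) :
    HodgeConjectureFor ((A.powSucc N).prod C).dim ((A.powSucc N).prod C).X :=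
  hodgeConjectureFor_prod_of_cmHodgeHypothesis hCM hL (A.powSucc N) C
    (hasNoTypeIVFactor_powSucc_of_isMurtyTypeWith hA N) hCt (hodgeConjectureFor_powSucc_of_isMurtyTypeWith hM hA N)

/-- **Murty power row on the predicate**, isogeny-closed: `X ∼ A^{N+1} × C` with `HasTotallyRealOddMaxSubfield A`,
`C` of CM type ⟹ HC(`X`) under HC_CM, the span fact and Murty's Thm. 2. [cite: Murty1988, Thm. 2]
[cite: vanGeemen1994HodgeAV, Lemma 3.7] [cite: Lombardo2016, Lemma 3.4 (p. 1229)] -/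
theorem hodgeConjectureFor_of_isIsogenous_powSucc_prod_of_hasTotallyRealOddMaxSubfield_of_cmHodgeHypothesis
    (hCM : ∀ B : AbelianVariety ℂ, Milne1999.CMHodgeHypothesisAt B)
    (hL : Lombardo2016_hodgeClassesProductSpan)
    (hM : Murty1988_hodgeClasses_divisorial_powers_totallyRealMaxSubfield_oddHalfRank)
    {X A C : AbelianVariety ℂ} (hA : HasTotallyRealOddMaxSubfield A) {N : ℕ} (hCt : Milne1999.IsOfCMType C)
    (hX : AbelianVariety.IsIsogenous X ((A.powSucc N).prod C)) : HodgeConjectureFor X.dim X.X := by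
  obtain ⟨K, _, _, φ, m, hA⟩ := hA
  exact HodgeConjectureFor.of_isIsogenous hX
    (hodgeConjectureFor_powSucc_prod_of_isMurtyTypeWith_of_cmHodgeHypothesis hCM hL hM hA N C hCt)

/-! ### §3 Two type I–III blocks: `A^{M+1} × B^{N+1}` has no type-IV factor (frame-ready; HC of the product itself is Hazama's territory, not claimed) -/

/-- `A^{M+1} × B^{N+1}` for `End⁰(A)`, `End⁰(B)` totally real fields has no factor of type IV — so the frame
applies to `(A^{M+1} × B^{N+1}) × C` as soon as HC(`A^{M+1} × B^{N+1}`) is supplied (for non-isogenous `A`, `B`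
this is Hazama's theorem / Moonen–Zarhin Thm. (3.2)(1), NOT in the tree; nothing about it is claimed here).
[cite: MoonenZarhin1999LowDim, §1 and Thm. (3.2)] -/
theorem hasNoTypeIVFactor_powSucc_prod_powSucc_of_isTotallyReal (A B : AbelianVariety ℂ)
    (hFA : IsField A.endAlgebra) [IsTotallyReal (EndField A hFA)] (hFB : IsField B.endAlgebra)
    [IsTotallyReal (EndField B hFB)] (M N : ℕ) :
    HasNoTypeIVFactor ((A.powSucc M).prod (B.powSucc N)) :=
  (hasNoTypeIVFactor_of_isTotallyReal A hFA).powSucc_prod_powSucc (hasNoTypeIVFactor_of_isTotallyReal B hFB) M N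

/-- Frame on two blocks: HC_CM ∧ hL ∧ HC(`A^{M+1} × B^{N+1}`) ⟹ HC(`(A^{M+1} × B^{N+1}) × C`) for `A`, `B` without
type-IV factor and `C` of CM type. [cite: MoonenZarhin1999LowDim, §1 and Thm. (3.2)] [cite: Lombardo2016, Lemma 3.4 (p. 1229)] -/
theorem hodgeConjectureFor_powSucc_prod_powSucc_prod_of_cmHodgeHypothesis
    (hCM : ∀ B : AbelianVariety ℂ, Milne1999.CMHodgeHypothesisAt B)
    (hL : Lombardo2016_hodgeClassesProductSpan) (A B C : AbelianVariety ℂ) (hA : HasNoTypeIVFactor A)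
    (hB : HasNoTypeIVFactor B) (hCt : Milne1999.IsOfCMType C) (M N : ℕ)
    (hAB : HodgeConjectureFor ((A.powSucc M).prod (B.powSucc N)).dim ((A.powSucc M).prod (B.powSucc N)).X) :
    HodgeConjectureFor (((A.powSucc M).prod (B.powSucc N)).prod C).dim
      (((A.powSucc M).prod (B.powSucc N)).prod C).X :=
  hodgeConjectureFor_prod_of_cmHodgeHypothesis hCM hL ((A.powSucc M).prod (B.powSucc N)) C
    (hA.powSucc_prod_powSucc hB M N) hCt hAB

/-! ### §4 On path -/

/-- **On path**: the Hodge conjecture for all smooth projective varieties implies every target above (each is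
HC of a product abelian variety). [cite: Deligne2000, §1] -/
theorem hodgeConjectureFor_powSucc_prod_of_hodgeConjecture
    (h : ∀ ⦃n : ℕ⦄ ⦃X : Motives.SchemeOver ℂ⦄, Motives.IsSmoothProjective n X → HodgeConjectureFor n X)
    (A C : AbelianVariety ℂ) (N : ℕ) :
    HodgeConjectureFor ((A.powSucc N).prod C).dim ((A.powSucc N).prod C).X :=
  hodgeConjectureFor_prod_of_hodgeConjecture h (A.powSucc N) C

end Literature.AlgebraicGeometry.HodgeTheory

end
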